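import Summits.CriticalPhenomena.PercolationContinuityZ3.Theorems.PercNearOneGluingAdditiveGluingK0CovTransferQOfSDMarkov
import HarnessLib

/-!
# Crux `PercNearOneGluing.AdditiveGluing` (stmt-CriticalPhenomena-4576): the kernel (T) follows from the WEAKER dominance statement (SD_N)

Support file (`--supports stmt-CriticalPhenomena-4576`, helper; depth seat (d) exchange-certificate form, gen g4).
No definitions, no named facts, no sorries.

Weighted graph on `Fin n` (`μ = prodBernoulli w`), relays `u, v`, target `b`, observer `o`, spectator `c`; `D = {u ↮ v}`,
`N = {c ↮ u} ∩ {c ↮ v}` (NOT intersected with `D`), `L = C_v` (open edge cluster).  The registered kernel stub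
`stub_k0CovTransferQ_c9` reads
  (T)  `μ(D)·(μ(D∩ub∩vo)·μ(N) − μ(D∩ub∩vc)·μ(N∩oc)) ≤ μ(D∩ub)·(μ(D∩vo)·μ(N) − μ(D∩vc)·μ(N∩oc))`.
The landed reduction `k0CovTransferQ_of_SD` (file `…K0CovTransferQOfSD.lean`) derives (T) from c11's dominance statement (SD), whose
threshold is `π_T3 = μ(D∩N∩oc)/μ(D∩N)`, together with the attachment transfer `μ(D∩N)·μ(N∩oc) ≤ μ(D∩N∩oc)·μ(N)` (γ″, i.e. `π_N ≤ π_T3`).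
This file records the sharper bookkeeping fact that the kernel needs only the WEAKER statement with the threshold
`π_N = μ(N∩oc)/μ(N)` that actually occurs in (T):

  (SD_N)  for every event `U` increasing in `C_v`:
          `μ(N∩oc)·(μ(D)·μ(D∩U∩vc) − μ(D∩U)·μ(D∩vc)) ≤ μ(N)·(μ(D)·μ(D∩U∩vo) − μ(D∩U)·μ(D∩vo))`,

i.e. `Cov_D(1_U, 1{o∈L}) ≥ π_N · Cov_D(1_U, 1{c∈L})`.  Since `Cov_D(1_U, 1{c∈L}) ≥ 0` (BHK Thm. 1.3) and `π_N ≤ π_T3` (γ″), (SD) ⟹ (SD_N);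
in the ghost form of the exchange-certificate memos the first slot of (SD_N) is a ONE-cluster quantity (`C_c` avoiding `v`, killed by the
`u`-edges), and no attachment transfer is needed any more.

* `covTransfer_of_SD_const` : the domain-Markov averaging of `covTransferD_of_SD` for ARBITRARY constants `(t, t')` in place of
  `(μ(D∩N), μ(D∩N∩oc))` — the proof of that theorem is linear in the pair.
* `k0CovTransferQ_of_SDN` : (SD_N) for all `C_v`-increasing `U` ⟹ the registered signature of `stub_k0CovTransferQ_c9` at all tuples.
[cite: VandenbergHaggstromKahn2005, §1 pp. 7–8, display (10)] [cite: KozmaNitzan2024, Lemma 4 (p. 9), Question 7 (p. 36)]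
-/

namespace Summit.CriticalPhenomena.PercolationContinuityZ3.Theorems

open MeasureTheory Set Literature.Probability.LatticeModels Literature.Probability.Percolation
open Literature.Probability.Percolation.BHK2006 (weight weight_nonneg)

noncomputable section

open K0CovTransferQOfSD in
/-- **Domain-Markov averaging with arbitrary constants.**  For reals `t, t'`: if for every event `U` increasing in `C_v`
`t'·(μ(D)·μ(D∩U∩vc) − μ(D∩U)·μ(D∩vc)) ≤ t·(μ(D)·μ(D∩U∩vo) − μ(D∩U)·μ(D∩vo))` (`D = {u↮v}`), then
`t·(μ(D)·μ(D∩ub∩vo) − μ(D∩ub)·μ(D∩vo)) ≤ t'·(μ(D)·μ(D∩ub∩vc) − μ(D∩ub)·μ(D∩vc))`: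
conditionally on `C_v`, `{u ↔ b}` is decided in fresh variables `η` off `C̄_v`, the events `U_η = {u ↮ b in η ∖ C̄_v}` are increasing in
`C_v`, and both sides are `weight(η)`-averages of the hypothesis at `U_η` (`real_D_ub_eq`, `real_D_conn_ub_eq`).
[cite: VandenbergHaggstromKahn2005, §1 pp. 7–8, display (10)] -/
theorem covTransfer_of_SD_const {n : ℕ} (w : Sym2 (Fin n) → unitInterval) (o b u v c : Fin n) (t t' : ℝ)
    (hSD : ∀ U : Set (BondConfig (Fin n)),
      (∀ ⦃ω ω' : BondConfig (Fin n)⦄, openEdgeCluster ω v ⊆ openEdgeCluster ω' v → ω ∈ U → ω' ∈ U) →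
      t' * ((prodBernoulli w).real ((openConn u v)ᶜ : Set (BondConfig (Fin n))) *
              (prodBernoulli w).real ((openConn u v)ᶜ ∩ U ∩ openConn v c : Set (BondConfig (Fin n))) -
            (prodBernoulli w).real ((openConn u v)ᶜ ∩ U : Set (BondConfig (Fin n))) *
              (prodBernoulli w).real ((openConn u v)ᶜ ∩ openConn v c : Set (BondConfig (Fin n)))) ≤
        t * ((prodBernoulli w).real ((openConn u v)ᶜ : Set (BondConfig (Fin n))) *
              (prodBernoulli w).real ((openConn u v)ᶜ ∩ U ∩ openConn v o : Set (BondConfig (Fin n))) -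
            (prodBernoulli w).real ((openConn u v)ᶜ ∩ U : Set (BondConfig (Fin n))) *
              (prodBernoulli w).real ((openConn u v)ᶜ ∩ openConn v o : Set (BondConfig (Fin n))))) :
    t * ((prodBernoulli w).real ((openConn u v)ᶜ : Set (BondConfig (Fin n))) *
            (prodBernoulli w).real ((openConn u v)ᶜ ∩ openConn u b ∩ openConn v o : Set (BondConfig (Fin n))) -
          (prodBernoulli w).real ((openConn u v)ᶜ ∩ openConn u b : Set (BondConfig (Fin n))) *
            (prodBernoulli w).real ((openConn u v)ᶜ ∩ openConn v o : Set (BondConfig (Fin n)))) ≤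
      t' * ((prodBernoulli w).real ((openConn u v)ᶜ : Set (BondConfig (Fin n))) *
            (prodBernoulli w).real ((openConn u v)ᶜ ∩ openConn u b ∩ openConn v c : Set (BondConfig (Fin n))) -
          (prodBernoulli w).real ((openConn u v)ᶜ ∩ openConn u b : Set (BondConfig (Fin n))) *
            (prodBernoulli w).real ((openConn u v)ᶜ ∩ openConn v c : Set (BondConfig (Fin n)))) := by
  set μ := prodBernoulli w with hμ
  set w' : Sym2 (Fin n) → ℝ := fun e => (w e : ℝ) with hw'
  set d := μ.real ((openConn u v)ᶜ : Set (BondConfig (Fin n))) with hd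
  set dvo := μ.real ((openConn u v)ᶜ ∩ openConn v o : Set (BondConfig (Fin n))) with hdvo
  set pc := μ.real ((openConn u v)ᶜ ∩ openConn v c : Set (BondConfig (Fin n))) with hpc
  -- per-η quantities
  set fU : Set (Sym2 (Fin n)) → ℝ := fun η => μ.real ((openConn u v)ᶜ ∩ ({ω' | b = u ∨ ∃ e ∈ openEdgeCluster (η \ {d | ∃ y ∈ d, y = v ∨ ∃ d' ∈ openEdgeCluster ω' v, y ∈ d'}) u, b ∈ e} : Set (BondConfig (Fin n)))ᶜ : Set (BondConfig (Fin n)))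
    with hfU
  set fUo : Set (Sym2 (Fin n)) → ℝ := fun η =>
    μ.real ((openConn u v)ᶜ ∩ ({ω' | b = u ∨ ∃ e ∈ openEdgeCluster (η \ {d | ∃ y ∈ d, y = v ∨ ∃ d' ∈ openEdgeCluster ω' v, y ∈ d'}) u, b ∈ e} : Set (BondConfig (Fin n)))ᶜ ∩ openConn v o : Set (BondConfig (Fin n))) with hfUo
  set fUc : Set (Sym2 (Fin n)) → ℝ := fun η =>
    μ.real ((openConn u v)ᶜ ∩ ({ω' | b = u ∨ ∃ e ∈ openEdgeCluster (η \ {d | ∃ y ∈ d, y = v ∨ ∃ d' ∈ openEdgeCluster ω' v, y ∈ d'}) u, b ∈ e} : Set (BondConfig (Fin n)))ᶜ ∩ openConn v c : Set (BondConfig (Fin n))) with hfUc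
  have hB : μ.real ((openConn u v)ᶜ ∩ openConn u b : Set (BondConfig (Fin n))) = ∑ η, weight w' η * (d - fU η) :=
    real_D_ub_eq w b u v
  have hBo : μ.real ((openConn u v)ᶜ ∩ openConn u b ∩ openConn v o : Set (BondConfig (Fin n))) =
      ∑ η, weight w' η * (dvo - fUo η) := real_D_conn_ub_eq w o b u v
  have hBc : μ.real ((openConn u v)ᶜ ∩ openConn u b ∩ openConn v c : Set (BondConfig (Fin n))) =
      ∑ η, weight w' η * (pc - fUc η) := real_D_conn_ub_eq w c b u v
  have hm : ∑ ω, weight w' ω = 1 := s1gen_sum_weight w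
  -- the hypothesis at each `U_η`
  have hη : ∀ η, 0 ≤ weight w' η * (t * (d * fUo η - fU η * dvo) - t' * (d * fUc η - fU η * pc)) := by
    intro η
    refine mul_nonneg (weight_nonneg (fun e => (w e).2.1) (fun e => (w e).2.2) η) (sub_nonneg.2 ?_)
    exact hSD ({ω' | b = u ∨ ∃ e ∈ openEdgeCluster (η \ {d | ∃ y ∈ d, y = v ∨ ∃ d' ∈ openEdgeCluster ω' v, y ∈ d'}) u, b ∈ e} : Set (BondConfig (Fin n)))ᶜ (compl_Vaux_mono u v b η)
  have hsum := Finset.sum_nonneg fun η (_ : η ∈ Finset.univ) => hη η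
  -- rewrite the goal as that sum
  rw [hB, hBo, hBc]
  have e1 : ∀ g : Set (Sym2 (Fin n)) → ℝ, ∀ a : ℝ,
      ∑ η, weight w' η * (a - g η) = a - ∑ η, weight w' η * g η := by
    intro g a
    simp only [mul_sub, Finset.sum_sub_distrib, ← Finset.sum_mul, hm, one_mul]
  have eR : ∑ η, weight w' η * (t * (d * fUo η - fU η * dvo) - t' * (d * fUc η - fU η * pc)) =
      t * d * (∑ η, weight w' η * fUo η) - t * dvo * (∑ η, weight w' η * fU η) -
        t' * d * (∑ η, weight w' η * fUc η) + t' * pc * (∑ η, weight w' η * fU η) := by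
    simp only [Finset.mul_sum, ← Finset.sum_sub_distrib, ← Finset.sum_add_distrib]
    refine Finset.sum_congr rfl fun η _ => ?_
    ring
  have expand : t' * (d * ∑ η, weight w' η * (pc - fUc η) - (∑ η, weight w' η * (d - fU η)) * pc) -
      t * (d * ∑ η, weight w' η * (dvo - fUo η) - (∑ η, weight w' η * (d - fU η)) * dvo) =
      ∑ η, weight w' η * (t * (d * fUo η - fU η * dvo) - t' * (d * fUc η - fU η * pc)) := by
    rw [e1 fUc pc, e1 fU d, e1 fUo dvo, eR]
    ring
  linarith [expand, hsum]

/-- **(SD_N) ⟹ (T) at all tuples.**  If the dominance statement with the UNCONDITIONED threshold pair `(μ(N), μ(N∩oc))`,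
`N = {c↮u}∩{c↮v}`, holds for every event `U` increasing in `C_v` — (SD_N):
`μ(N∩oc)·(μ(D)·μ(D∩U∩vc) − μ(D∩U)·μ(D∩vc)) ≤ μ(N)·(μ(D)·μ(D∩U∩vo) − μ(D∩U)·μ(D∩vo))` — then the registered kernel
`stub_k0CovTransferQ_c9` (= (T)) holds at every `(n, w, o, b, u, v, c)`.  Compared with `k0CovTransferQ_of_SD` the hypothesis is weaker
(`π_N ≤ π_T3` by the attachment transfer, and `Cov_D(1_U, 1{c∈C_v}) ≥ 0`) and no attachment transfer is used: `covTransfer_of_SD_const`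
with `(t, t') = (μ(N), μ(N∩oc))` is (T) up to expanding brackets.
[cite: VandenbergHaggstromKahn2005, §1 pp. 7–8, display (10)] [cite: KozmaNitzan2024, Lemma 4 (p. 9), Question 7 (p. 36)] -/
theorem k0CovTransferQ_of_SDN
    (hSDN : ∀ (n : ℕ) (w : Sym2 (Fin n) → unitInterval) (o u v c : Fin n) (U : Set (BondConfig (Fin n))),
      (∀ ⦃ω ω' : BondConfig (Fin n)⦄, openEdgeCluster ω v ⊆ openEdgeCluster ω' v → ω ∈ U → ω' ∈ U) →
      (prodBernoulli w).real ((openConn c u)ᶜ ∩ (openConn c v)ᶜ ∩ openConn o c : Set (BondConfig (Fin n))) *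
          ((prodBernoulli w).real ((openConn u v)ᶜ : Set (BondConfig (Fin n))) *
              (prodBernoulli w).real ((openConn u v)ᶜ ∩ U ∩ openConn v c : Set (BondConfig (Fin n))) -
            (prodBernoulli w).real ((openConn u v)ᶜ ∩ U : Set (BondConfig (Fin n))) *
              (prodBernoulli w).real ((openConn u v)ᶜ ∩ openConn v c : Set (BondConfig (Fin n)))) ≤
        (prodBernoulli w).real ((openConn c u)ᶜ ∩ (openConn c v)ᶜ : Set (BondConfig (Fin n))) *
          ((prodBernoulli w).real ((openConn u v)ᶜ : Set (BondConfig (Fin n))) *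
              (prodBernoulli w).real ((openConn u v)ᶜ ∩ U ∩ openConn v o : Set (BondConfig (Fin n))) -
            (prodBernoulli w).real ((openConn u v)ᶜ ∩ U : Set (BondConfig (Fin n))) *
              (prodBernoulli w).real ((openConn u v)ᶜ ∩ openConn v o : Set (BondConfig (Fin n))))) :
    ∀ (n : ℕ) (w : Sym2 (Fin n) → unitInterval) (o b u v c : Fin n), (Literature.Probability.LatticeModels.prodBernoulli w).real ((Literature.Probability.Percolation.openConn u v)ᶜ : Set (Literature.Probability.Percolation.BondConfig (Fin n))) * ((Literature.Probability.LatticeModels.prodBernoulli w).real ((Literature.Probability.Percolation.openConn u v)ᶜ ∩ Literature.Probability.Percolation.openConn u b ∩ Literature.Probability.Percolation.openConn v o : Set (Literature.Probability.Percolation.BondConfig (Fin n))) * (Literature.Probability.LatticeModels.prodBernoulli w).real ((Literature.Probability.Percolation.openConn c u)ᶜ ∩ (Literature.Probability.Percolation.openConn c v)ᶜ : Set (Literature.Probability.Percolation.BondConfig (Fin n))) - (Literature.Probability.LatticeModels.prodBernoulli w).real ((Literature.Probability.Percolation.openConn u v)ᶜ ∩ Literature.Probability.Percolation.openConn u b ∩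 Literature.Probability.Percolation.openConn v c : Set (Literature.Probability.Percolation.BondConfig (Fin n))) * (Literature.Probability.LatticeModels.prodBernoulli w).real ((Literature.Probability.Percolation.openConn c u)ᶜ ∩ (Literature.Probability.Percolation.openConn c v)ᶜ ∩ Literature.Probability.Percolation.openConn o c : Set (Literature.Probability.Percolation.BondConfig (Fin n)))) ≤ (Literature.Probability.LatticeModels.prodBernoulli w).real ((Literature.Probability.Percolation.openConn u v)ᶜ ∩ Literature.Probability.Percolation.openConn u b : Set (Literature.Probability.Percolation.BondConfig (Fin n))) * ((Literature.Probability.LatticeModels.prodBernoulli w).real ((Literature.Probability.Percolation.openConn u v)ᶜ ∩ Literature.Probability.Percolation.openConn v o : Set (Literature.Probability.Percolation.BondConfig (Fin n))) * (Literature.Probability.LatticeModels.prodBernoulli w).real ((Literature.Probability.Percolation.openConn c u)ᶜ ∩ (Literature.Probability.Percolation.openConn c v)ᶜ : Set (Literature.Probability.Percolation.BondConfig (Fin n))) - (Literature.Probability.LatticeModels.prodBernoulli w).real ((Literature.Probability.Percolation.openConn u v)ᶜ ∩ Literature.Probability.Percolation.openConn v c : Set (Literature.Probability.Percolation.BondConfig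 (Fin n))) * (Literature.Probability.LatticeModels.prodBernoulli w).real ((Literature.Probability.Percolation.openConn c u)ᶜ ∩ (Literature.Probability.Percolation.openConn c v)ᶜ ∩ Literature.Probability.Percolation.openConn o c : Set (Literature.Probability.Percolation.BondConfig (Fin n)))) := by
  intro n w o b u v c
  set μ := prodBernoulli w with hμ
  set Nn := μ.real ((openConn c u)ᶜ ∩ (openConn c v)ᶜ : Set (BondConfig (Fin n))) with hNn
  set NJ := μ.real ((openConn c u)ᶜ ∩ (openConn c v)ᶜ ∩ openConn o c : Set (BondConfig (Fin n))) with hNJ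
  have key := covTransfer_of_SD_const w o b u v c Nn NJ (fun U hU => hSDN n w o u v c U hU)
  set d := μ.real ((openConn u v)ᶜ : Set (BondConfig (Fin n))) with hd
  set dB := μ.real ((openConn u v)ᶜ ∩ openConn u b : Set (BondConfig (Fin n))) with hdB
  set dBo := μ.real ((openConn u v)ᶜ ∩ openConn u b ∩ openConn v o : Set (BondConfig (Fin n))) with hdBo
  set dBc := μ.real ((openConn u v)ᶜ ∩ openConn u b ∩ openConn v c : Set (BondConfig (Fin n))) with hdBc
  set dvo := μ.real ((openConn u v)ᶜ ∩ openConn v o : Set (BondConfig (Fin n))) with hdvo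
  set pc := μ.real ((openConn u v)ᶜ ∩ openConn v c : Set (BondConfig (Fin n))) with hpc
  show d * (dBo * Nn - dBc * NJ) ≤ dB * (dvo * Nn - pc * NJ)
  linarith [key]

end

end Summit.CriticalPhenomena.PercolationContinuityZ3.Theorems
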